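import Summits.ResolutionOfSingularities.ResolutionOfSingularities.Theorems.PurelyInseparableDim4ChartAtlasSNCGoodNearFarPackage
import Summits.ResolutionOfSingularities.ResolutionOfSingularities.Theorems.PurelyInseparableDim4AtlasMemberDefs
import Summits.ResolutionOfSingularities.ResolutionOfSingularities.Theorems.PurelyInseparableDim4AtlasReadingState
import HarnessLib

/-!
# Purely inseparable four-folds: the atlas package of a LINEAR ESCAPING child — all readings are TRANSLATED charts with EXPLICIT states
# (brick S3 (c) v4 «atlas members», tranche 1, brick A1b; cell `res-dim4-pi`)

[OURS · counted 0] (D-0157 DOOR 2; host item stmt-ResolutionOfSingularities-16155, helper). Nothing here proves resolution of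
singularities in dimension ≥ 4 / characteristic `p`. typ-2's S3-N1/N2 package `ChartDictionary.globalCentre_atlas_package_boundary_nearFar`
(p704887) SPECIALISED to the tranche-1 format of `res-dim4-typ-3/S3c-V4-ATLAS-MEMBERS-DESIGN.md` §7: a next centre `(j, b, S″)` with
`j ∈ S″` (inside the new exceptional divisor) and `b|_S = 0` (the point lies on every near old component). Then typ-2's near
conditions hold trivially, its far conditions are void, every SHEAR re-centring is the plain TRANSLATION by `b`
(`Θ_l(x_i) = x_i + b_i` on every chart `l`), and by `eq_deletePthPowers_of_isClean_pow_add` (p711075) the extra chart `x_l`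
(`l ∈ S ∖ S″`) reads the transform as `(z^p + F_l)·𝒪` with the EXPLICIT state `F_l = (escState p S l b s).F =
deletePthPowers (translate b (chartTransform p S l s.F))` and the global centre as `𝓘Λ (insert l (S″ ∖ {j}))` — exactly the data
`extraReading` of the v4 definitions (p711312) prescribes.

* **`globalCentre_atlas_package_linearEscaping`**. AI-produced formalisation, weaker than expert review.
bears_on: LADDER-RESOLUTION:D157-DOOR2 (res-dim4-pi · S3 (c) v4 A1b).
-/

set_option linter.dupNamespace false -- D-0017: single-problem summit path `Summit.<S>.<S>.…` by design

noncomputable section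

open MvPolynomial Finset CategoryTheory AlgebraicGeometry Opposite TopologicalSpace
open AlgebraicGeometry.Scheme.IdealSheafData (ofIdealTop vanishingIdeal)

namespace Summit.ResolutionOfSingularities.ResolutionOfSingularities.Theorems.PIDim4

open Literature.AlgebraicGeometry.Resolution
open Literature.AlgebraicGeometry.Resolution.Hauser2010
open Literature.AlgebraicGeometry.Resolution.AffinePointBlowup (P A γ coord Wtop ξ)
open Literature.Barriers.ResolutionOfSingularities

namespace Equimultiple

section LinearEscaping

variable {K : Type} [Field K] {p : ℕ} [hp : Fact p.Prime] [CharP K p]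
  {S S' : Finset (Fin 4)} {j : Fin 4} {b : Fin 4 → K} {W : Scheme.{0}} {π : W ⟶ P 4 K}

omit hp [CharP K p] in
/-- A shear whose shear coefficients vanish is the translation: if `τ x_j = x_j`, `τ x_l = x_l`, `τ x_i = x_i + b_i x_j` on `S ∖ {j, l}`,
`τ x_k = x_k + b_k` off `S`, and `b|_S = 0`, then `τ = translate b`. [folklore] -/
theorem shear_apply_eq_translate_of_forall_eq_zero (hj : j ∈ S) {l : Fin 4} (hl : l ∈ S) (hbS : ∀ i ∈ S, b i = 0)
    (τ : MvPolynomial (Fin 4) K ≃ₐ[K] MvPolynomial (Fin 4) K) (hτj : τ (X j) = X j) (hτl : τ (X l) = X l)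
    (hτS : ∀ i ∈ S, i ≠ j → i ≠ l → τ (X i) = X i + C (b i) * X j) (hτk : ∀ k ∉ S, τ (X k) = X k + C (b k))
    (Q : MvPolynomial (Fin 4) K) : τ Q = PointBlowup.translate b Q := by
  have hX : ∀ i : Fin 4, τ (X i) = X i + C (b i) := by
    intro i
    by_cases hiS : i ∈ S
    · by_cases hij : i = j
      · subst hij; rw [hτj, hbS _ hj, C_0, add_zero]
      by_cases hil : i = l
      · subst hil; rw [hτl, hbS _ hl, C_0, add_zero]
      rw [hτS i hiS hij hil, hbS i hiS, C_0, zero_mul, add_zero]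
    · exact hτk i hiS
  change (τ : MvPolynomial (Fin 4) K →ₐ[K] MvPolynomial (Fin 4) K) Q =
    aeval (fun i => (X i + C (b i) : MvPolynomial (Fin 4) K)) Q
  congr 1
  exact MvPolynomial.algHom_ext fun i => by
    change τ (X i) = aeval (fun i => (X i + C (b i) : MvPolynomial (Fin 4) K)) (X i)
    rw [hX, aeval_X]

/-- **THE ATLAS PACKAGE OF A LINEAR ESCAPING CHILD.** typ-2's `globalCentre_atlas_package_boundary_nearFar` for `j ∈ S″`, `b|_S = 0`:
the re-centring of record `Θⱼ` of the main chart, the global centre `Zc`, its three admissibility conjuncts for the transformed marked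
ideal WITH the near/far boundary, the cover of `V(Zc)` by the charts `l ∈ S ∖ S″.erase j`, and on every extra chart `l ∈ S ∖ S″` a
TRANSLATION re-centring `Θ` (`Θ x_i = x_i + b_i`) reading the transform as `(z^p + (escState p S l b s).F)·𝒪` (clean, `≠ 0`,
order `≥ p` along the centre) and `Zc` as `𝓘Λ (insert l (S″ ∖ {j}))`, the exceptional divisor as `x_l`.
[cite: BierstoneGrigorievMilmanWlodarczyk2011, §4 Step 2b; Def. 3.1.3 (4)] [cite: HauserPerlega2019PRIMS, §2] -/
theorem globalCentre_atlas_package_linearEscaping [IsAlgClosed K] [DecidableEq K] (hj : j ∈ S) (hjS' : j ∈ S')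
    (hbS : ∀ i ∈ S, b i = 0) (s : State K) (hF : s.F ≠ 0) (hclean : HauserPerlega.IsClean p s.F)
    (hperm : (p : ℕ∞) ≤ CentreBlowup.ordAlong S s.F)
    (hπ : IsBlowup π (AffineCoordBlowup.𝓘Λ 4 K (insert 0 (Fin.succ '' (S : Set (Fin 4))))))
    (hperm' : (p : ℕ∞) ≤ CentreBlowup.ordAlong S' (CentreBlowup.step p S j b s).F)
    (ms fs : List (Fin 4)) (c d : Fin 4 → K) (hc : ∀ i ∈ S, c i = 0) (hfs : ∀ i ∈ fs, i ∈ S ∧ d i ≠ 0) (hdis : ∀ i ∈ fs, i ∉ ms) :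
    ∃ (Θⱼ : A 4 K ≃ₐ[K] A 4 K) (h : MvPolynomial (Fin 4) K) (_ : IsIso (CommRingCat.ofHom (Θⱼ : A 4 K →+* A 4 K))),
      Θⱼ (X 0) = X 0 + rename Fin.succ h ∧ (∀ i : Fin 4, Θⱼ (X i.succ) = X i.succ + C (b i)) ∧
      let φⱼ := Spec.map (CommRingCat.ofHom (Θⱼ : A 4 K →+* A 4 K)) ≫ AffineCoordBlowup.chartImm hπ (ChartDictionary.succ_mem_centreVars hj)
      let Zc := vanishingIdeal (closureImage φⱼ ((AffineCoordBlowup.𝓘Λ 4 K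
        (insert 0 (Fin.succ '' (S' : Set (Fin 4))))).support : Set (P 4 K)))
      let M' := ((⟨hypSheaf p s.F, (ms.map fun i => ofIdealTop (Ideal.span {(γ 4 K).symm (X i.succ + C (c i))})) ++
          fs.map fun i => ofIdealTop (Ideal.span {(γ 4 K).symm (X i.succ + C (d i))}), p⟩ :
        MarkedIdeal (P 4 K)).transform π (AffineCoordBlowup.𝓘Λ 4 K (insert 0 (Fin.succ '' (S : Set (Fin 4))))))
      (M'.ideal.comap φⱼ = hypSheaf p (CentreBlowup.step p S j b s).F ∧
        Zc.comap φⱼ = AffineCoordBlowup.𝓘Λ 4 K (insert 0 (Fin.succ '' (S' : Set (Fin 4)))) ∧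
        Scheme.IsRegular Zc.subscheme ∧ (Zc.support : Set W) ⊆ M'.support ∧ HasSNCWith M'.boundary Zc) ∧
      ((Zc.support : Set W) ⊆ ⋃ (l : Fin 4) (hl : l ∈ S \ S'.erase j),
        ((AffineCoordBlowup.chartImm hπ (ChartDictionary.succ_mem_centreVars (Finset.mem_sdiff.mp hl).1)).opensRange : Set W)) ∧
      ∀ (l : Fin 4) (hl : l ∈ S), l ∉ S' →
        ∃ (Θ : A 4 K ≃ₐ[K] A 4 K) (g : MvPolynomial (Fin 4) K) (_ : IsIso (CommRingCat.ofHom (Θ : A 4 K →+* A 4 K))),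
          Θ (X 0) = X 0 + rename Fin.succ g ∧ (∀ i : Fin 4, Θ (X i.succ) = X i.succ + C (b i)) ∧
          let φ := Spec.map (CommRingCat.ofHom (Θ : A 4 K →+* A 4 K)) ≫
            AffineCoordBlowup.chartImm hπ (ChartDictionary.succ_mem_centreVars hl)
          M'.ideal.comap φ = hypSheaf p (escState p S l b s).F ∧
          Zc.comap φ = AffineCoordBlowup.𝓘Λ 4 K (insert 0 (Fin.succ '' ((insert l (S'.erase j) : Finset (Fin 4)) : Set (Fin 4)))) ∧
          (escState p S l b s).F ≠ 0 ∧ HauserPerlega.IsClean p (escState p S l b s).F ∧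
          (p : ℕ∞) ≤ CentreBlowup.ordAlong (insert l (S'.erase j)) (escState p S l b s).F ∧
          ((AffineCoordBlowup.𝓘Λ 4 K (insert 0 (Fin.succ '' (S : Set (Fin 4))))).comap π).comap φ =
            ofIdealTop (Ideal.span {(γ 4 K).symm (X l.succ + C 0)}) := by
  -- typ-2's near/far hypotheses are trivial / void here
  have hB1 : j ∈ ms → ∀ m ∈ ms, m ∈ S → m ∈ S' → b m = 0 := fun _ m _ hmS _ => hbS m hmS
  have hB2 : ∀ m ∈ ms, ∀ m' ∈ ms, m ∈ S → m' ∈ S → m ∈ S' → m' ∈ S' → b m ≠ 0 → b m' ≠ 0 → m = m' :=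
    fun m _ m' _ hmS _ _ _ hbm _ => absurd (hbS m hmS) hbm
  have hH1 : j ∉ S' → ∀ i ∈ fs, i ∈ S' → b i ≠ 0 → j ∈ fs → d i ≠ b i * d j := fun h => absurd hjS' h
  have hH2 : j ∉ S' → ∀ i ∈ fs, ∀ k ∈ fs, i ≠ k → i ∈ S' → k ∈ S' → b i ≠ 0 → b k ≠ 0 → d i * b k ≠ d k * b i :=
    fun h => absurd hjS' h
  obtain ⟨Θⱼ, h, hiso, hΘ0, hΘs, hmain, hcov, hrest⟩ :=
    ChartDictionary.globalCentre_atlas_package_boundary_nearFar hj (hbS j hj) s hF hclean hperm hπ hperm' ms fs c d hc hfs hdis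
      hB1 hB2 hH1 hH2
  refine ⟨Θⱼ, h, hiso, hΘ0, hΘs, hmain, hcov, fun l hl hlS' => ?_⟩
  have hjl : j ≠ l := fun h => hlS' (h ▸ hjS')
  obtain ⟨Θ, τ, g, hisoΘ, h0', hτ, hτj, hτl, hτS, hτb, hM, hZ, hne, hcl, hord, hE⟩ := hrest l hl hlS' hjl
  -- the shear is the translation, the state is forced
  have hτQ : ∀ Q, τ Q = PointBlowup.translate b Q :=
    shear_apply_eq_translate_of_forall_eq_zero hj hl hbS τ hτj hτl hτS hτb
  have hΘs' : ∀ i : Fin 4, Θ (X i.succ) = X i.succ + C (b i) := fun i => by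
    rw [hτ i, hτQ]
    change rename Fin.succ (aeval (fun i => (X i + C (b i) : MvPolynomial (Fin 4) K)) (X i)) = _
    rw [aeval_X, map_add, rename_X, rename_C]
  have hFl : g ^ p + τ (CentreBlowup.chartTransform p S l s.F) = (escState p S l b s).F := by
    rw [eq_deletePthPowers_of_isClean_pow_add p g _ hcl, hτQ]
    rfl
  have hTl : (if j ∈ S' then insert l (S'.erase j) else S') = insert l (S'.erase j) := if_pos hjS'
  refine ⟨Θ, g, hisoΘ, h0', hΘs', ?_, ?_, ?_, ?_, ?_, hE⟩
  · rw [← hFl]; exact hM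
  · rw [← hTl]; exact hZ
  · rw [← hFl]; exact hne
  · rw [← hFl]; exact hcl
  · rw [← hFl, ← hTl]; exact hord

end LinearEscaping

end Equimultiple

end Summit.ResolutionOfSingularities.ResolutionOfSingularities.Theorems.PIDim4

end
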